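import Summits.ABC.IUTFork.Joshi.ATS4DescentSpineAbcGenuine
import Summits.ABC.IUTFork.Joshi.ATS4MainBoundsGenuineTheta
import HarnessLib

/-!
# [J-IV] (arXiv:2403.10430v2) §6 ⟶ §7: the E5 DESCENT SPINE to `ABC` as typed AT JOSHI'S OWN DATA — the genuine Legendre
# theta tower `L_tpd ⊆ L ⊆ L′ = F_tpd ⊆ F ⊆ K` (Rmk. 6.1.2) — with the tower conditions and the point identifications PROVED

Proof-only companion (0 defs) of the abc-iut cell, branch E «type Joshi's construction, test vs S» (rung LADDER-ABC:A2.E), seat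
abc-iut-E-t30 (gen 3), slot T-30 = [J-IV] §6.1–6.5; authors-first sequel of `Joshi/ATS4MainBoundsGenuineTheta.lean` (E-t30 gen 2,
p440894) on the BUILT parent `Joshi/ATS4DescentSpineAbcGenuine.lean` (E-t33 gen 4, p440771), every input BY NAME. SOURCE: K. Joshi,
*Construction of Arithmetic Teichmüller Spaces IV*, arXiv:2403.10430v2 (unrefereed; bib `Joshi2024ATS4`), Thm. 6.1.1 p.58 l.1–23,
Rmk. 6.1.2 p.58 l.24–27 («the same as [Mochizuki 2021d, Theorem 1.10] with η_prm = 60»: `L_tpd/L/L′ ↦ F_tpd/F/K`), §6.4 p.59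
l.25 – p.60 l.30, §6.12 p.72 l.2–31, §7.1 p.73 l.9–35, §7.2 p.75 l.27–30; page/line = the cell's render
`HOME/lit/renders/Joshi-arxiv-2403.10430/`.

FRAMING (binding): this file COMPOSES implications between statements typed from a third party's unrefereed text. It takes NO side
on [IUTchIII] Cor. 3.12 / [IUTchIV] Thm. 1.10, on Joshi's claims, or on Mochizuki's report on them, and makes NO abc claim: every
printed assertion of Joshi's descent that is not a classical number-field fact is a HYPOTHESIS by name (E-t31's `LocusVolumeDatum.*`
inputs of §6.8–§6.11 — among them `LowerBound` = [J-III] Cor. 9.11.1.1 at `φ(y₀)`, Joshi's analogue of Cor. 3.12 —, the glue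
`MainBoundGlue`, T-29's «prime of Lemma 5.8.7» `IsLem587Prime`); the conclusion `Thm721` / `ABC` is reached ONLY under them.
Typed ≠ proved; typed AS A CANDIDATE ≠ endorsed.

WHAT IS HERE (all PROVED; composition + two classical identifications).

p440771's `abc_of_genuineDescentInputs` runs Joshi's descent on an ABSTRACT Galois tower of number fields `L_tpd → L → L′`, asking per
λ-line point for eight classical CONDITIONS on the tower (support compatibility `hV`, `hV′`; degree divisibilities `hdvd`, `hdvd′`;
unramified/tame clauses `hunr`, `htame`, `hunr′`, `htame′`) and two IDENTIFICATIONS with the point (`log(𝔮_L) = Cor22.logQAvoid P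
{2,ℓ}`, `log(𝔡^{L_tpd}) + log(𝔣_{L_tpd}) = log-diff + log-cond`). At the data Joshi's Thm. 6.1.1 is ABOUT (Rmk. 6.1.2 p.58 l.24–27; §4.1.2 (9) p.38
l.10 «L = L_tpd(√−1, C_{L_tpd}[3·5])»; `L′` «the number field determined by Initial Theta Data», p.39 l.17–18 — Mochizuki's `K`) —
in the cell's vocabulary the genuine Legendre theta tower of the point `P = λ ∈ U_X(F_tpd)`:
`F` a theta field of `P` (`Cor22.IsThetaField P F`), `K ⊇ F` Galois inside the `ℓ`-division field of the Legendre curve `E_F`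
(an `F`-embedding `ψ : K → F̄` with `ker ρ̄_{E_F,ℓ} ≤ Gal(F̄/ψK)`), `ℓ ≥ 7` prime, Tate-divisor data T-26's `ofNFPoint · {2,ℓ}`
(p440894 §1) — ALL TEN are theorems:
1. `thm611Consumed_of_thm611Left_le` — E-t33's bridge `thm611Consumed_of_thm611Left` (p437546) with the conductor identification
   weakened to «log(𝔡^{L_tpd}) + log(𝔣_{L_tpd}) ≤ log-diff + log-cond» (the coefficient `1 + 20·d/ℓ` is `≥ 0`).
2. `MainBoundDatum.thetaTower_logq_eq` — «log(𝔮_L) = logQAvoid P {2,ℓ}» at the theta datum (T-26's Prop. 4.4.4 `prop444_extend` +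
   `logq_ofNFPoint`, p430434); `thetaTower_logDiffCond_eq` / `_le` — «log(𝔡^{F_tpd}) + log(𝔣_{F_tpd}) = log-diff(λ) + log-cond^{∤2ℓ}(λ)
   ≤ log-diff(λ) + log-cond(λ)» (the tree's `Cor22.logCondAvoid_le_logCond`, [IUTchIV] p.43 «log(𝔣^{F_tpd}) ≤ log-cond_D(x_E)»).
3. `MainBoundDatum.thetaTower_thm611Left_of_descent` — glue + §6.8–§6.11 inputs + `ℓ ≥ 7` ⟹ the FIRST inequality of Thm. 6.1.1 at
   the theta datum, with NO §6.4 / ramification / degree / support binder (`thm611_left_of_lem642b` p439256 ∘ `thetaTower_lem642b`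
   p440894 — the eight conditions are the theorems behind the tree's `Cor22.ndeg_differentDivisor_add_logCondOver_thetaTower_le`).
   E-t26 gen 3's `ThetaTower.thm611_left_of_descent_ofNFPointOver` (p442100, `Joshi/ATS4MainBoundsThetaTower.lean`, the TWO-STEP route)
   reaches the same inequality under one support-avoidance input `hS` («no bad place of λ over a prime of S» = Prop. 4.1.1 (2) on the
   λ-line at `S = {2,ℓ}`, vacuous at `S = ∅`); the COMPOSITE route used here needs no `hS` at `S = {2,ℓ}` — the support of §7.1's
   `log(q) = log(q^{∤2ℓ}(λ))`. `thm611_thetaTower_of_descent` — Thm. 6.1.1 AS PRINTED (both inequalities) there (`thetaTower_thm611_iff`).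
4. `thm611Consumed_thetaTower_of_descent` — per point: ⟹ §7.1's consumed form `Thm611Consumed d P ℓ`, both identifications
   DISCHARGED (items 1–2); only `d_mod ≤ d` of the point data remains.
5. `abc_of_thetaTowerDescentInputs` — THE E5 SPINE END TO END AT JOSHI'S DATA: if at every compactly bounded `Z` with (5.6.2) and
   every `d ≥ 1`, off an exceptional set of bounded height, every point of `Z ∩ U(Q̄)_{≤d}` carries {a theta field `F`, `K` Galois
   inside the `ℓ`-division field, `ℓ ≥ 7` a prime of Lemma 5.8.7, `V^{odd,ss} ≠ ∅` (`0 < log 𝔮_F`), any `L_mod` with `d_mod ≤ d`,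
   E-t31's carrier `dd` with its NAMED §6.8–§6.11 inputs glued to the theta datum}, then `ABC`. Versus p440771: the per-point
   binder has lost `hV, hdvd, hunr, htame, hV′, hdvd′, hunr′, htame′, hq-identification, hLD` — nothing of §6.8–§6.11 or of [J-III]
   is discharged. `thm611Consumed_of_logQAvoid_eq_zero` records that the complementary case `V^{odd,ss} = ∅` is vacuous-true.
RUNG CURRENCY (A2.E, §M E5 sentence): «Joshi's descent inputs at every λ-line point ⟹ `ABC` as typed» now reads, AT HIS OWN DATA,
with antecedent = {theta field, `K ⊆ F(E[ℓ])` Galois, `ℓ ≥ 7` prime of Lem. 5.8.7, `V^{odd,ss} ≠ ∅`, `d_mod ≤ d`, [J-III] Cor. 9.11.1.1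
at `φ(y₀)` (`LowerBound`), (6.11.1), Prop. 6.10.9 on `V^dst_ℚ`, the component sums, (6.8.11), Lem. 6.7.8, the two Frobenius-shift
equalities, «(1/2ℓ) log q = |log q_ℓ|», glue}. RELATION TO OUR `Statement` (recorded, not imported — R14): as in p437546 (X-03
p428664, X-13 p433287). Shape (E-PLAN R2/R9): volume-shaped, S-bypassed; no TEST line. Theorems only; standard axioms; no `sorry`,
instance, notation, `def` or new `Prop` fact. [claim: Joshi2024ATS4, status: disputed]; [claim: Joshi2024ATS3, status: disputed].
-/

noncomputable section

namespace Summit.ABC.IUTFork.Joshi.ATS4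

open Literature.NumberTheory.DiophantineGeometry Literature.NumberTheory.DiophantineGeometry.GenEll
open Literature.NumberTheory.EllipticCurves
open Literature.IUT.LogVolume Literature.IUT.LogVolume.Cor22
open NumberField IsDedekindDomain

/-! ## 1. E-t33's bridge with the conductor identification weakened to `≤` -/

/-- **Thm. 6.1.1's FIRST inequality gives §7.1's consumed form under `log(𝔡^{L_tpd}) + log(𝔣_{L_tpd}) ≤ log-diff + log-cond`**
(p.58 l.5–16 ⟹ p.73 l.13–35 with `d_mod ↦ d`, `e*_mod ↦ δ`): E-t33's `thm611Consumed_of_thm611Left` asked for EQUALITY of the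
`L_tpd`-terms with the point's `log-diff + log-cond`; since the coefficient `1 + 20·d_mod/ℓ` is nonnegative, `≤` suffices — which is
what the genuine Tate-divisor data give ([IUTchIV] p.43 «log(𝔣^{F_tpd}) ≤ log-cond_D(x_E)»: the support avoids the places over `2ℓ`).
PROVED (real arithmetic). [folklore] -/
theorem thm611Consumed_of_thm611Left_le (𝔐 : MainBoundDatum) (h : 1 / 6 * 𝔐.logq ≤ 𝔐.boundLtpd) {d : ℕ} (hdmod : 𝔐.dmod ≤ d)
    (P : NFPoint) (hq : 𝔐.logq = logQAvoid P {2, 𝔐.ell})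
    (hLD : 𝔐.logDiffLtpd + 𝔐.logCondLtpd ≤ P.logDiff + P.logCond) : Thm611Consumed d P 𝔐.ell := by
  unfold MainBoundDatum.boundLtpd MainBoundDatum.coeff at h
  unfold Thm611Consumed
  rw [← hq]
  have hℓ : (0 : ℝ) < 𝔐.ell := by exact_mod_cast 𝔐.ell_prime.pos
  have hd' : (𝔐.dmod : ℝ) ≤ d := by exact_mod_cast hdmod
  have hd0 : (0 : ℝ) ≤ 𝔐.dmod := by positivity
  have he : (𝔐.emod : ℝ) ≤ 𝔐.dmod := by exact_mod_cast 𝔐.emod_le_dmod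
  have hLD0 : 0 ≤ P.logDiff + P.logCond := add_nonneg P.logDiff_nonneg P.logCond_nonneg
  have hcoeff : 0 ≤ 1 + 20 * (𝔐.dmod : ℝ) / 𝔐.ell := by positivity
  have h1 := mul_le_mul_of_nonneg_left hLD hcoeff
  have hes : (𝔐.estar : ℝ) ≤ delta d := by
    unfold MainBoundDatum.estar delta; push_cast; nlinarith
  have hc : 20 * (𝔐.dmod : ℝ) / 𝔐.ell ≤ 20 * (d : ℝ) / 𝔐.ell :=
    div_le_div_of_nonneg_right (by linarith) hℓ.le
  have h2 := mul_le_mul_of_nonneg_right hc hLD0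
  have h3 := mul_le_mul_of_nonneg_right hes hℓ.le
  nlinarith [h, h1, h2, h3]

/-- The complementary case of the hypothesis «V^{odd,ss} ≠ ∅» (Thm. 6.1.1's `0 < log(q)`, p.57 l.21–22): if the `q`-parameter
divisor of `λ` away from `{2, ℓ}` vanishes, §7.1's consumed form holds with nothing to prove (its right-hand side is `≥ 0`).
PROVED. [folklore] -/
theorem thm611Consumed_of_logQAvoid_eq_zero {d : ℕ} {P : NFPoint} {ℓ : ℕ} (h : logQAvoid P {2, ℓ} = 0) :
    Thm611Consumed d P ℓ := by
  unfold Thm611Consumed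
  rw [h, mul_zero]
  have hLD0 : 0 ≤ P.logDiff + P.logCond := add_nonneg P.logDiff_nonneg P.logCond_nonneg
  have hδ : 0 ≤ delta d := by unfold delta; positivity
  positivity

/-! ## 2. The point identifications at the genuine Legendre theta tower are THEOREMS -/

namespace MainBoundDatum

section Theta

variable (Lmod : Type*) [Field Lmod] [NumberField Lmod]
variable {P : NFPoint} {F : Type} [Field F] [NumberField F] [Algebra P.F F]
  {K : Type} [Field K] [NumberField K] [Algebra F K] [Algebra P.F K] [IsScalarTower P.F F K]
  (ψ : K →ₐ[F] AlgebraicClosure F)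
variable {ℓ : ℕ} (hℓ : ℓ.Prime) (h5 : 5 ≤ ℓ)
variable (hq : 0 < (TateDivisorDatum.ofNFPointOver P {2, ℓ} F).logq)

omit [IsScalarTower P.F F K] in
/-- **«log(q) = log(q^{∤{2,ℓ}}(λ))» at the theta datum is a THEOREM**: `log(𝔮_F)` of T-26's Tate-divisor datum of `λ` over the
theta field `F` equals the cell's `Cor22.logQAvoid P {2,ℓ}` computed over `F_tpd` — Joshi's Prop. 4.4.4 «log(𝔮_L) = log(𝔮_{L_tpd})»
(p.41, T-26's `prop444_extend`) and `logq_ofNFPoint` ([IUTchIV] Cor. 2.2 (i) p.41). PROVED. [cite: Mochizuki2012, IUTchIV Thm 1.10 p.23] -/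
theorem thetaTower_logq_eq :
    (ofGenuine Lmod hℓ h5 (TateDivisorDatum.ofNFPoint P {2, ℓ})
      (TateDivisorDatum.ofNFPointOver P {2, ℓ} F)
      (TateDivisorDatum.ofNFPointOver P {2, ℓ} K) hq).logq = logQAvoid P {2, ℓ} := by
  show (TateDivisorDatum.ofNFPointOver P {2, ℓ} F).logq = _
  rw [← TateDivisorDatum.logq_ofNFPoint P {2, ℓ}]
  exact TateDivisorDatum.prop444_extend P F {2, ℓ}

omit [IsScalarTower P.F F K] in
/-- **«log(𝔡^{L_tpd}) + log(𝔣^{L_tpd})» at the theta datum IS `log-diff(λ) + log-cond^{∤{2,ℓ}}(λ)`** (`logDifferent_eq_logDiff`,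
`logf_ofNFPoint_eq_logCondAvoid`, p440894 §1; [IUTchIV] p.43 «log-diff_X(x_E) = log(𝔡^{F_tpd})»). PROVED.
[cite: Mochizuki2012, IUTchIV Cor 2.2 (ii) p.43] -/
theorem thetaTower_logDiffCond_eq :
    (ofGenuine Lmod hℓ h5 (TateDivisorDatum.ofNFPoint P {2, ℓ})
      (TateDivisorDatum.ofNFPointOver P {2, ℓ} F)
      (TateDivisorDatum.ofNFPointOver P {2, ℓ} K) hq).logDiffLtpd +
    (ofGenuine Lmod hℓ h5 (TateDivisorDatum.ofNFPoint P {2, ℓ})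
      (TateDivisorDatum.ofNFPointOver P {2, ℓ} F)
      (TateDivisorDatum.ofNFPointOver P {2, ℓ} K) hq).logCondLtpd = P.logDiff + logCondAvoid P {2, ℓ} := by
  show logDifferent P.F + (TateDivisorDatum.ofNFPoint P {2, ℓ}).logf = _
  rw [TateDivisorDatum.logDifferent_eq_logDiff, TateDivisorDatum.logf_ofNFPoint_eq_logCondAvoid]

omit [IsScalarTower P.F F K] in
/-- **… hence `≤ log-diff(λ) + log-cond(λ)`** ([IUTchIV] p.43 / p.48 «log(𝔣^{F_tpd}) ≤ log-cond_D(x_E) … immediately from the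
definitions»: the tree's `Cor22.logCondAvoid_le_logCond`). This is the form item 1 consumes. PROVED.
[cite: Mochizuki2012, IUTchIV Cor 2.2 (ii) p.43] -/
theorem thetaTower_logDiffCond_le (hU : P.InU) :
    (ofGenuine Lmod hℓ h5 (TateDivisorDatum.ofNFPoint P {2, ℓ})
      (TateDivisorDatum.ofNFPointOver P {2, ℓ} F)
      (TateDivisorDatum.ofNFPointOver P {2, ℓ} K) hq).logDiffLtpd +
    (ofGenuine Lmod hℓ h5 (TateDivisorDatum.ofNFPoint P {2, ℓ})
      (TateDivisorDatum.ofNFPointOver P {2, ℓ} F)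
      (TateDivisorDatum.ofNFPointOver P {2, ℓ} K) hq).logCondLtpd ≤ P.logDiff + P.logCond := by
  rw [thetaTower_logDiffCond_eq]
  exact add_le_add le_rfl (logCondAvoid_le_logCond P hU {2, ℓ})

/-! ## 3. The E5 junction at the theta datum: no §6.4 / tower-condition binder -/

variable {dd : LocusVolumeDatum}
  (G : MainBoundGlue (ofGenuine Lmod hℓ h5 (TateDivisorDatum.ofNFPoint P {2, ℓ})
    (TateDivisorDatum.ofNFPointOver P {2, ℓ} F) (TateDivisorDatum.ofNFPointOver P {2, ℓ} K) hq) dd)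
include G

/-- **The FIRST inequality of Thm. 6.1.1 at the genuine theta datum from the §6.8–§6.11 inputs + glue + `ℓ ≥ 7` ALONE**
(§6.12 p.72 l.2–31): E-t30's junction `thm611_left_of_lem642b` (the §6.4 inputs enter §6.12 only through Lemma 6.4.2 (2)) fed with
`thetaTower_lem642b` — Lemma 6.4.2 (2) is UNCONDITIONAL on the tower `F_tpd ⊆ F ⊆ K` (p440894: the tree's hypothesis-free Step (ii)
bound `Cor22.ndeg_differentDivisor_add_logCondOver_thetaTower_le`). Remaining hypotheses: `λ ∈ U_X`, `F` a theta field, `K/F` Galois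
inside the `ℓ`-division field, `ℓ ≥ 7` prime, `0 < log(𝔮_F)`, the glue, and E-t31's NAMED inputs (6.11.1), Prop. 6.10.9 on `V^dst_ℚ`,
the component sums, (6.8.11), Lem. 6.7.8, LOWER BOUND = [J-III] Cor. 9.11.1.1 at `φ(y₀)`, the two Frobenius-shift equalities,
«(1/2ℓ) log q = |log q_ℓ|». (E-t26 gen 3's two-step `ThetaTower.thm611_left_of_descent_ofNFPointOver`, p442100, is the same junction
under the extra support input `hS` = Prop. 4.1.1 (2) at `S = {2,ℓ}`; none is needed on this route.) PROVED (composition).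
[claim: Joshi2024ATS4, status: disputed] -/
theorem thetaTower_thm611Left_of_descent (hU : P.InU) (hF : IsThetaField P F) [IsGalois F K] (h7 : 7 ≤ ℓ)
    (hK : letI := thetaCurve_isElliptic hU F
      ((thetaCurve P F).galoisRepTorsion (ℓ : ℤ)).ker ≤ ψ.fieldRange.fixingSubgroup)
    (h₁ : dd.Eq6111) (h₂ : ∀ p ∈ dd.Vdst, dd.Prop6109 p) (h₃ : dd.ComponentSums) (h₅ : dd.Eq6811) (h₆ : dd.Lem678)
    (h₇ : dd.LowerBound) (h₈ : dd.FrobShiftQ) (h₉ : dd.FrobShiftVol) (hD : dd.LogqDictionary) :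
    1 / 6 * (ofGenuine Lmod hℓ h5 (TateDivisorDatum.ofNFPoint P {2, ℓ})
      (TateDivisorDatum.ofNFPointOver P {2, ℓ} F) (TateDivisorDatum.ofNFPointOver P {2, ℓ} K) hq).logq ≤
    (ofGenuine Lmod hℓ h5 (TateDivisorDatum.ofNFPoint P {2, ℓ})
      (TateDivisorDatum.ofNFPointOver P {2, ℓ} F) (TateDivisorDatum.ofNFPointOver P {2, ℓ} K) hq).boundLtpd :=
  thm611_left_of_lem642b G h7 (thetaTower_lem642b Lmod ψ hℓ h5 hq hU hF h7 hK) h₁ h₂ h₃ h₅ h₆ h₇ h₈ h₉ hD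

/-- **Theorem 6.1.1 AS PRINTED — both inequalities (p.58 l.1–23) — at the genuine theta datum from the §6.8–§6.11 inputs + glue +
`ℓ ≥ 7`**: the first by `thetaTower_thm611Left_of_descent`, the second (Thm. 4.6.1 (2) for `L/L_tpd`) is the theorem
`thetaTower_diffCondMono` / `thetaTower_thm611_iff` (p440894). PROVED (composition); the [J-III] lower bound and the §6.8–§6.11
identities stay HYPOTHESES BY NAME. [claim: Joshi2024ATS4, status: disputed] -/
theorem thm611_thetaTower_of_descent (hU : P.InU) (hF : IsThetaField P F) [IsGalois F K] (h7 : 7 ≤ ℓ)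
    (hK : letI := thetaCurve_isElliptic hU F
      ((thetaCurve P F).galoisRepTorsion (ℓ : ℤ)).ker ≤ ψ.fieldRange.fixingSubgroup)
    (h₁ : dd.Eq6111) (h₂ : ∀ p ∈ dd.Vdst, dd.Prop6109 p) (h₃ : dd.ComponentSums) (h₅ : dd.Eq6811) (h₆ : dd.Lem678)
    (h₇ : dd.LowerBound) (h₈ : dd.FrobShiftQ) (h₉ : dd.FrobShiftVol) (hD : dd.LogqDictionary) :
    (ofGenuine Lmod hℓ h5 (TateDivisorDatum.ofNFPoint P {2, ℓ})
      (TateDivisorDatum.ofNFPointOver P {2, ℓ} F) (TateDivisorDatum.ofNFPointOver P {2, ℓ} K) hq).Thm611 :=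
  (thetaTower_thm611_iff Lmod hℓ h5 hq).2
    (thetaTower_thm611Left_of_descent Lmod ψ hℓ h5 hq G hU hF h7 hK h₁ h₂ h₃ h₅ h₆ h₇ h₈ h₉ hD)

/-- **Per λ-line point, AT JOSHI'S DATA: §6.8–§6.11 inputs + glue + `ℓ ≥ 7` + `d_mod ≤ d` ⟹ §7.1's consumed form
`Thm611Consumed d P ℓ`, with BOTH point identifications DISCHARGED** (`thetaTower_logq_eq`, `thetaTower_logDiffCond_le` into
`thm611Consumed_of_thm611Left_le`; p.73 l.13–35, p.75 l.18–20). Compare p440771's `thm611Consumed_ofGenuine_of_descent`: its binders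
`hV, hdvd, hunr, htame, hV′, hdvd′, hunr′, htame′, hqP, hLD` are absent here. PROVED (composition). [claim: Joshi2024ATS4, status: disputed] -/
theorem _root_.Summit.ABC.IUTFork.Joshi.ATS4.thm611Consumed_thetaTower_of_descent (hU : P.InU) (hF : IsThetaField P F)
    [IsGalois F K] (h7 : 7 ≤ ℓ)
    (hK : letI := thetaCurve_isElliptic hU F
      ((thetaCurve P F).galoisRepTorsion (ℓ : ℤ)).ker ≤ ψ.fieldRange.fixingSubgroup)
    (h₁ : dd.Eq6111) (h₂ : ∀ p ∈ dd.Vdst, dd.Prop6109 p) (h₃ : dd.ComponentSums) (h₅ : dd.Eq6811) (h₆ : dd.Lem678)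
    (h₇ : dd.LowerBound) (h₈ : dd.FrobShiftQ) (h₉ : dd.FrobShiftVol) (hD : dd.LogqDictionary)
    {d : ℕ} (hdmod : dMod Lmod ≤ d) : Thm611Consumed d P ℓ :=
  thm611Consumed_of_thm611Left_le
    (ofGenuine Lmod hℓ h5 (TateDivisorDatum.ofNFPoint P {2, ℓ})
      (TateDivisorDatum.ofNFPointOver P {2, ℓ} F) (TateDivisorDatum.ofNFPointOver P {2, ℓ} K) hq)
    (thetaTower_thm611Left_of_descent Lmod ψ hℓ h5 hq G hU hF h7 hK h₁ h₂ h₃ h₅ h₆ h₇ h₈ h₉ hD) hdmod P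
    (thetaTower_logq_eq Lmod hℓ h5 hq) (thetaTower_logDiffCond_le Lmod hℓ h5 hq hU)

end Theta

end MainBoundDatum

/-! ## 4. THE E5 SPINE END TO END AT JOSHI'S DATA, to `ABC` as typed -/

/-- **THE E5 SPINE END TO END AT THE GENUINE LEGENDRE THETA TOWER, to `ABC` as typed.** If at every compactly bounded `Z` with
(5.6.2) (`Cor22.Hypotheses`) and every `d ≥ 1`, off an exceptional set of bounded height (Thm. 5.7.1, p.73 l.9–13), every point
`P = λ` of `Z ∩ U(Q̄)_{≤d}` carries: a theta field `F` of `λ` (`Cor22.IsThetaField`, Joshi's `L`, §4.1.2 (9)), `K ⊇ F` Galois inside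
the `ℓ`-division field of the Legendre curve `E_F` (Joshi's `L′`), `ℓ ≥ 7` a prime of Lemma 5.8.7 (T-29's `IsLem587Prime`),
`V^{odd,ss} ≠ ∅` (`0 < log(𝔮_F)`, p.57 l.21–22), a number field `L_mod` with `d_mod ≤ d` (`U(Q̄)_{≤d}`, p.73 l.33–35), and E-t31's
§6.8–§6.11 carrier `dd` glued (`MainBoundGlue`) to the theta datum `MainBoundDatum.ofGenuine L_mod … (ofNFPoint λ {2,ℓ})
(ofNFPointOver λ {2,ℓ} F) (ofNFPointOver λ {2,ℓ} K)` and satisfying its NAMED inputs — (6.11.1), Prop. 6.10.9 on `V^dst_ℚ`, the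
component sums, (6.8.11), Lemma 6.7.8, the LOWER BOUND = [J-III] Cor. 9.11.1.1 at `φ(y₀)`, the two Frobenius-shift equalities,
«(1/2ℓ) log q = |log q_ℓ|» —, then `ABC` (`abc_of_thm721` ∘ `thm721_of_thm611OnLambdaLine`). PROVED AS AN IMPLICATION: versus
p440771's `abc_of_genuineDescentInputs` the eight tower conditions and the two point identifications are no longer in the
antecedent (theorems at this tower: p440894, §2 above); nothing of §6.8–§6.11 or of [J-III] is discharged; NO abc claim.
[claim: Joshi2024ATS4, status: disputed] -/
theorem abc_of_thetaTowerDescentInputs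
    (h : ∀ Z : CBData, Hypotheses Z → ∀ d : ℕ, 0 < d → ∃ Exc : Set NFPoint, (∃ H : ℝ, ∀ P ∈ Exc, P.ht ≤ H) ∧
      ∀ P ∈ Z.toSet ∩ UPle d, P ∉ Exc →
        ∃ (F : Type) (_ : Field F) (_ : NumberField F) (_ : Algebra P.F F)
          (K : Type) (_ : Field K) (_ : NumberField K) (_ : Algebra F K) (_ : Algebra P.F K) (_ : IsScalarTower P.F F K)
          (_ : IsGalois F K) (ψ : K →ₐ[F] AlgebraicClosure F) (ℓ : ℕ) (hℓ : ℓ.Prime) (h5 : 5 ≤ ℓ)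
          (hU : P.InU) (_ : IsThetaField P F)
          (_ : letI := thetaCurve_isElliptic hU F
            ((thetaCurve P F).galoisRepTorsion (ℓ : ℤ)).ker ≤ ψ.fieldRange.fixingSubgroup)
          (hq : 0 < (TateDivisorDatum.ofNFPointOver P {2, ℓ} F).logq)
          (Lmod : Type) (_ : Field Lmod) (_ : NumberField Lmod) (dd : LocusVolumeDatum),
          MainBoundGlue (MainBoundDatum.ofGenuine Lmod hℓ h5 (TateDivisorDatum.ofNFPoint P {2, ℓ})
            (TateDivisorDatum.ofNFPointOver P {2, ℓ} F) (TateDivisorDatum.ofNFPointOver P {2, ℓ} K) hq) dd ∧ 7 ≤ ℓ ∧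
          (dd.Eq6111 ∧ (∀ p ∈ dd.Vdst, dd.Prop6109 p) ∧ dd.ComponentSums ∧ dd.Eq6811 ∧ dd.Lem678 ∧ dd.LowerBound ∧
            dd.FrobShiftQ ∧ dd.FrobShiftVol ∧ dd.LogqDictionary) ∧
          (IsLem587Prime d P ℓ ∧ dMod Lmod ≤ d)) : ABC :=
  abc_of_thm721 <| thm721_of_thm611OnLambdaLine fun Z hZ d hd => by
    obtain ⟨Exc, hExc, glue⟩ := h Z hZ d hd
    refine ⟨Exc, hExc, fun P hP hnot => ?_⟩
    obtain ⟨F, _, _, _, K, _, _, _, _, _, _, ψ, ℓ, hℓ, h5, hU, hF, hK, hq, Lmod, _, _, dd, G, h7,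
      ⟨h₁, h₂, h₃, h₅, h₆, h₇, h₈, h₉, hD⟩, ⟨hℓP, hdmod⟩⟩ := glue P hP hnot
    exact ⟨ℓ, hℓP, thm611Consumed_thetaTower_of_descent Lmod ψ hℓ h5 hq G hU hF h7 hK h₁ h₂ h₃ h₅ h₆ h₇ h₈ h₉ hD hdmod⟩

end Summit.ABC.IUTFork.Joshi.ATS4

end
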